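import Summits.RiemannHypothesis.RiemannHypothesis.Theorems.MotivicDoorFfRank

/-!
# Motivic door, ff calibration: THE INERTIA COUNTS of the formal Néron–Severi form —
`(n₊, n₀, n₋) = (1, M + 1 − r, 1 + r)`, `r = min(M + 1, D)` (pub-rhdoor, unit `ffcal`, HOME/FFCAL.md §0 A4;
seat planner-pub-rhdoor-ffcal-g5-0; sequel of `MotivicDoorFfRank`)

HONEST FRAMING (cell charter, verbatim): lottery ticket at the motivic door; RH probability negligible;
consolation prizes are real: a new semi-local Weil-positivity theorem, or a located gap in the
Connes–Consani programme, plus the ff-door theorem.  Nothing in this file is a statement about `ζ`.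

WORK TYPE: new formalisation of [folklore] linear algebra (Sylvester counting for a real symmetric form
with positive index `≤ 1`), binding BY NAME to the tree's formal Néron–Severi Gram matrix
`G_M = nsGram q h M` on the classes `{H, V, Γ_0, …, Γ_M}` of the formal surface `C × C`
(`MotivicDoorFfHodgeIndex`: `H² = V² = 0`, `H·V = 1`, `Γ_m·H = q^m`, `Γ_m·V = 1`,
`Γ_m·Γ_n = q^min (1 + q^|m−n| − a_|m−n|)`), its intersection pairing `inter q h M x y = x ⬝ᵥ G_M y`, the
Hodge index inequality `posIndex_le_one_of_ffRH` (`MotivicDoorFfHodgeSignature`) and the rank theorem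
`rank_nsGram : rk G_M = r + 2` (`MotivicDoorFfRank`).  It closes the last CERTIFIED-only column of FFCAL.md
§0 A4: the inertia COUNTS.  No RH claim in either direction; for `h` the `L`-polynomial of a curve,
RH(q,h) is Weil's theorem and every statement below is then unconditional [folklore: Weil 1948;
Hartshorne GTM 52 Ex. V.1.9–1.10 (Hodge index on `C × C`); Sylvester's law of inertia].

`D := (frobRoots h).toFinset.card` (number of distinct complex roots of `h`), `r := min (M + 1) D`.  The
signature is expressed as EIGENVALUE SIGN COUNTS of the real symmetric matrix `G_M` (`nsGram_isHermitian`,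
Mathlib's `Matrix.IsHermitian.eigenvalues` / `eigenvectorUnitary` / `spectral_theorem`); by Sylvester's law
these are the inertia counts that FFCAL computed by exact integer `LDLᵀ`.  Under RH(q,h) and `q ≥ 1`:

* `inter_eigenvectorUnitary_mulVec`: diagonalisation `x·x = Σ_i λ_i y_i²` for `x = U y`, `U` the
  orthogonal eigenvector matrix.
* `card_pos_eigenvalues_nsGram : #{i | λ_i > 0} = 1` — at most one from `posIndex_le_one_of_ffRH` (two
  orthonormal eigenvectors with positive eigenvalues would span a positive definite plane), at least one
  from `(H+V)² = 2 > 0` (`inter_hv_self`).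
* `card_zero_eigenvalues_nsGram : #{i | λ_i = 0} = M + 1 − r` — from `rank_nsGram` and
  `Matrix.IsHermitian.rank_eq_card_non_zero_eigs`.
* `card_neg_eigenvalues_nsGram : #{i | λ_i < 0} = r + 1` — by counting, `(M + 3) − 1 − (M + 1 − r)`.

So on every window `M` of every RH-true datum, for every multiplicity pattern of the roots, the formal
Néron–Severi form has signature `(1, M + 1 − r, 1 + r)` — FFCAL A4's triple, now a theorem.

DATA context (not used in any proof): FFCAL.md §0 A4 — blind inertia `(1, M+1−r, 1+r)` CERTIFIED by exact
integer `LDLᵀ` on 221/221 windows of the panels G*∪N and 2195/2195 census windows (= pub-weilobs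
`x_ff.hodge` on 328/328).  This file and `MotivicDoorFfRank` turn that column from CERTIFIED into PROVED.
-/

set_option linter.dupNamespace false  -- the mandated namespace repeats `RiemannHypothesis`

noncomputable section

open Polynomial Matrix Finset
open scoped ComplexOrder ComplexConjugate

namespace Summit.RiemannHypothesis.RiemannHypothesis.Theorems.MotivicDoor.FfInertia

open Summit.RiemannHypothesis.RiemannHypothesis.Theorems.PfPersistence.FfAngleTwin
open Summit.RiemannHypothesis.RiemannHypothesis.Theorems.MotivicDoor.FfRealLattice
open Summit.RiemannHypothesis.RiemannHypothesis.Theorems.MotivicDoor.FfCliff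
open Summit.RiemannHypothesis.RiemannHypothesis.Theorems.MotivicDoor.FfHodgeIndex
open Summit.RiemannHypothesis.RiemannHypothesis.Theorems.MotivicDoor.FfHodgeSignature
open Summit.RiemannHypothesis.RiemannHypothesis.Theorems.MotivicDoor.FfRank

variable (q : ℕ) (h : ℤ[X]) (M : ℕ)

/-! ## The signature of the formal Néron–Severi form: `(n₊, n₀, n₋) = (1, M + 1 − r, 1 + r)` -/

/-- The formal Néron–Severi matrix is Hermitian (real symmetric), so Mathlib's spectral theory
(`Matrix.IsHermitian.eigenvalues`, `eigenvectorUnitary`) applies. [folklore] -/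
theorem nsGram_isHermitian : (nsGram q h M).IsHermitian :=
  Matrix.isHermitian_iff_isSymm.2 (nsGram_isSymm q h M)

/-- **DIAGONALISATION OF THE INTERSECTION FORM**: in the orthonormal eigenvector coordinates `x = U y`,
`x·x = Σ_i λ_i y_i²`. [folklore] -/
theorem inter_eigenvectorUnitary_mulVec (y : NSIndex M → ℝ) :
    inter q h M (((nsGram_isHermitian q h M).eigenvectorUnitary : Matrix (NSIndex M) (NSIndex M) ℝ) *ᵥ y)
        (((nsGram_isHermitian q h M).eigenvectorUnitary : Matrix (NSIndex M) (NSIndex M) ℝ) *ᵥ y)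
      = ∑ i, (nsGram_isHermitian q h M).eigenvalues i * y i ^ 2 := by
  set hG := nsGram_isHermitian q h M
  set U : Matrix (NSIndex M) (NSIndex M) ℝ := (hG.eigenvectorUnitary : Matrix (NSIndex M) (NSIndex M) ℝ)
    with hU
  have hstar : star U = Uᵀ := by
    rw [star_eq_conjTranspose, conjTranspose_eq_transpose_of_trivial]
  have hUU : Uᵀ * U = 1 := by
    have e := Unitary.coe_star_mul_self hG.eigenvectorUnitary
    rwa [← hU, hstar] at e
  have hG' : nsGram q h M = U * diagonal hG.eigenvalues * Uᵀ := by
    have e := hG.spectral_theorem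
    rw [Unitary.conjStarAlgAut_apply, ← hU, hstar] at e
    have ed : (RCLike.ofReal ∘ hG.eigenvalues : NSIndex M → ℝ) = hG.eigenvalues := by
      funext i; simp
    rw [ed] at e
    exact e
  have hmv : nsGram q h M *ᵥ (U *ᵥ y) = U *ᵥ (diagonal hG.eigenvalues *ᵥ y) := by
    calc nsGram q h M *ᵥ (U *ᵥ y) = (U * diagonal hG.eigenvalues * Uᵀ) *ᵥ (U *ᵥ y) := by rw [← hG']
      _ = U *ᵥ (diagonal hG.eigenvalues *ᵥ y) := by
          rw [mulVec_mulVec, Matrix.mul_assoc (U * diagonal hG.eigenvalues), hUU, Matrix.mul_one,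
            ← mulVec_mulVec]
  unfold inter
  rw [hmv, dotProduct_mulVec, ← mulVec_transpose, mulVec_mulVec, hUU, one_mulVec]
  simp only [dotProduct, mulVec_diagonal]
  exact Finset.sum_congr rfl fun i _ => by ring

/-- **`n₊ = 1`: EXACTLY ONE POSITIVE EIGENVALUE** on every window of an RH-true datum (`q ≥ 1`): at most
one by `posIndex_le_one_of_ffRH` (two orthonormal eigenvectors with positive eigenvalues would span a
positive definite plane), at least one because `(H+V)² = 2 > 0` (`inter_hv_self`). [folklore] -/
theorem card_pos_eigenvalues_nsGram (hq : 0 < q) (hRH : ∀ α ∈ frobRoots h, ‖α‖ = Real.sqrt q) :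
    Fintype.card {i // 0 < (nsGram_isHermitian q h M).eigenvalues i} = 1 := by
  set hG := nsGram_isHermitian q h M
  set U : Matrix (NSIndex M) (NSIndex M) ℝ := (hG.eigenvectorUnitary : Matrix (NSIndex M) (NSIndex M) ℝ)
    with hU
  have hstar : star U = Uᵀ := by
    rw [star_eq_conjTranspose, conjTranspose_eq_transpose_of_trivial]
  have hUUt : U * Uᵀ = 1 := by
    have e := Unitary.coe_mul_star_self hG.eigenvectorUnitary
    rwa [Unitary.coe_star, ← hU, hstar] at e
  have hdiag := inter_eigenvectorUnitary_mulVec q h M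
  -- at least one positive eigenvalue
  have hex : ∃ i, 0 < hG.eigenvalues i := by
    by_contra hno
    push Not at hno
    have h2 := inter_hv_self q h M
    have e : U *ᵥ (Uᵀ *ᵥ hv M) = hv M := by rw [mulVec_mulVec, hUUt, one_mulVec]
    rw [← e, hdiag] at h2
    have : ∑ i, hG.eigenvalues i * (Uᵀ *ᵥ hv M) i ^ 2 ≤ 0 :=
      Finset.sum_nonpos fun i _ => mul_nonpos_of_nonpos_of_nonneg (hno i) (sq_nonneg _)
    linarith
  -- at most one
  have huniq : ∀ i j, 0 < hG.eigenvalues i → 0 < hG.eigenvalues j → i = j := by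
    intro i j hi hj
    by_contra hij
    obtain ⟨a, b, hab, hle⟩ :=
      posIndex_le_one_of_ffRH q h hq hRH M (U *ᵥ Pi.single i 1) (U *ᵥ Pi.single j 1)
    let y : NSIndex M → ℝ := fun k => if k = i then a else if k = j then b else 0
    have hy : a • (U *ᵥ Pi.single i 1) + b • (U *ᵥ Pi.single j 1) = U *ᵥ y := by
      rw [← mulVec_smul, ← mulVec_smul, ← mulVec_add]
      congr 1
      funext k
      simp only [y, Pi.add_apply, Pi.smul_apply, Pi.single_apply, smul_eq_mul, mul_ite, mul_one, mul_zero]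
      by_cases hki : k = i
      · simp [hki, hij]
      · simp [hki]
    rw [hy, hdiag] at hle
    have hsum : ∑ k, hG.eigenvalues k * y k ^ 2 = hG.eigenvalues i * a ^ 2 + hG.eigenvalues j * b ^ 2 := by
      rw [Finset.sum_eq_add i j hij]
      · simp [y, Ne.symm hij]
      · intro k _ hk
        simp only [y, if_neg hk.1, if_neg hk.2]; ring
      · intro hi'; exact absurd (Finset.mem_univ i) hi'
      · intro hj'; exact absurd (Finset.mem_univ j) hj'
    rw [hsum] at hle
    rcases hab with ha | hb
    · have : 0 < hG.eigenvalues i * a ^ 2 := mul_pos hi (by positivity)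
      nlinarith [mul_nonneg hj.le (sq_nonneg b)]
    · have : 0 < hG.eigenvalues j * b ^ 2 := mul_pos hj (by positivity)
      nlinarith [mul_nonneg hi.le (sq_nonneg a)]
  obtain ⟨i₀, hi₀⟩ := hex
  rw [Fintype.card_eq_one_iff]
  exact ⟨⟨i₀, hi₀⟩, fun ⟨j, hj⟩ => Subtype.ext (huniq j i₀ hj hi₀)⟩

/-- **`n₀ = M + 1 − r`: THE NUMBER OF ZERO EIGENVALUES** (RH(q,h), `q ≥ 1`) — the dimension of the
radical, by `rank_nsGram` and `Matrix.IsHermitian.rank_eq_card_non_zero_eigs`. [folklore] -/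
theorem card_zero_eigenvalues_nsGram (hq : 0 < q) (hRH : ∀ α ∈ frobRoots h, ‖α‖ = Real.sqrt q) :
    Fintype.card {i // (nsGram_isHermitian q h M).eigenvalues i = 0}
      = M + 1 - min (M + 1) (frobRoots h).toFinset.card := by
  have h1 := (nsGram_isHermitian q h M).rank_eq_card_non_zero_eigs
  have h2 := Fintype.card_subtype_compl (fun i => (nsGram_isHermitian q h M).eigenvalues i = 0)
  have h3 : Fintype.card {i // (nsGram_isHermitian q h M).eigenvalues i = 0} ≤ Fintype.card (NSIndex M) :=
    Fintype.card_subtype_le _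
  rw [rank_nsGram q h M hq hRH] at h1
  simp only [Fintype.card_sum, Fintype.card_fin] at h2 h3
  simp only [ne_eq] at h1
  omega

/-- **`n₋ = r + 1`: THE NUMBER OF NEGATIVE EIGENVALUES** (RH(q,h), `q ≥ 1`), by counting:
`(M + 3) − 1 − (M + 1 − r)`.  With the two previous theorems: the formal Néron–Severi form of the window
`M` has signature `(n₊, n₀, n₋) = (1, M + 1 − r, 1 + r)`, `r = min(M + 1, D)` — FFCAL A4. [folklore] -/
theorem card_neg_eigenvalues_nsGram (hq : 0 < q) (hRH : ∀ α ∈ frobRoots h, ‖α‖ = Real.sqrt q) :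
    Fintype.card {i // (nsGram_isHermitian q h M).eigenvalues i < 0}
      = min (M + 1) (frobRoots h).toFinset.card + 1 := by
  set hG := nsGram_isHermitian q h M
  have hA := Fintype.card_subtype_compl (fun i => hG.eigenvalues i < 0)
  have hB : Fintype.card {i // ¬hG.eigenvalues i < 0}
      = Fintype.card {i // hG.eigenvalues i = 0 ∨ 0 < hG.eigenvalues i} :=
    Fintype.card_congr (Equiv.subtypeEquivRight fun i => by rw [not_lt, le_iff_eq_or_lt, eq_comm])
  have hC := Fintype.card_subtype_or_disjoint (fun i => hG.eigenvalues i = 0)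
    (fun i => 0 < hG.eigenvalues i)
    (Pi.disjoint_iff.2 fun i => Prop.disjoint_iff.2 fun hh => hh.2.ne' hh.1)
  have hle : Fintype.card {i // hG.eigenvalues i < 0} ≤ Fintype.card (NSIndex M) :=
    Fintype.card_subtype_le _
  rw [card_zero_eigenvalues_nsGram q h M hq hRH, card_pos_eigenvalues_nsGram q h M hq hRH] at hC
  simp only [Fintype.card_sum, Fintype.card_fin] at hA hle
  omega

end Summit.RiemannHypothesis.RiemannHypothesis.Theorems.MotivicDoor.FfInertia

end
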